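import Summits.MatrixMultiplication.MatrixMultiplication.Theorems.FarEdgeDescentTailShadow
import HarnessLib

/-!
# FarEdgeDescent — FAR-TAIL FREEDOM (IV): the characterisation as one `iff`

`FarEdgeDescentTailFreedom` (necessity) and `FarEdgeDescentTailShadow` (sufficiency) packaged into the single
statement the memo quotes, for an ABSTRACT 3D-lawful functional (symmetric, degree-1 homogeneous, subadditive,
monotone, sandwiched `max(a+c,a+b,b+c) ≤ W ≤ a+b+c`):

  `farPencil_iff` : a function `e` on `[1,∞)` is the far excess `W(1,x,1) − (x+1)` of SOME 3D-lawful `W`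
  iff `e` is convex, antitone, nonnegative and cube-line coupled `e(1) − e(x) ≤ (1 − e(1))/3 · (x − 1)`.

The one necessity not typed before for abstract `W` is ANTITONICITY: it follows from convexity and the ceiling
(`e ≤ 1`) alone — a convex function bounded above on a ray is non-increasing (`antitoneOn_of_convexOn_of_le`,
`farExcess_antitone_of_laws`).  Monotonicity of `W` is not used on the far ray; the sandwich is used only through the
floor `x+1 ≤ W(1,x,1)` and the ceiling `W(1,x,1) ≤ x+2`.
-/

set_option linter.dupNamespace false

noncomputable section

namespace Summit.MatrixMultiplication.MatrixMultiplication.Theorems.FarEdgeDescentTailClass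

open Set
open Summit.MatrixMultiplication.MatrixMultiplication.Theorems.FarEdgeDescentTailFreedom
open Summit.MatrixMultiplication.MatrixMultiplication.Theorems.FarEdgeDescentTailShadow

/-- A convex function bounded above on a ray `[a,∞)` is non-increasing there (if it rose between `x < y`, the
secant slopes beyond `y` would stay `≥` that positive slope and the function would exceed any bound). -/
theorem antitoneOn_of_convexOn_of_le {φ : ℝ → ℝ} {a M : ℝ} (hc : ConvexOn ℝ (Ici a) φ)
    (hM : ∀ x : ℝ, a ≤ x → φ x ≤ M) : AntitoneOn φ (Ici a) := by
  intro x hx y hy hxy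
  rcases hxy.eq_or_lt with rfl | hlt
  · exact le_rfl
  by_contra hne
  push Not at hne
  have hyx : 0 < y - x := by linarith
  have hs : 0 < (φ y - φ x) / (y - x) := div_pos (by linarith) hyx
  set s := (φ y - φ x) / (y - x) with hs_def
  have hgap : 0 < M + 1 - φ y := by linarith [hM y (mem_Ici.1 hy)]
  set z := y + (M + 1 - φ y) / s with hz_def
  have hyz : y < z := by
    have := div_pos hgap hs
    linarith
  have hz : z ∈ Ici a := mem_Ici.2 (le_trans (mem_Ici.1 hy) hyz.le)
  have hslope := hc.slope_mono_adjacent hx hz hlt hyz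
  have hzy : 0 < z - y := by linarith
  have h1 : s * (z - y) ≤ φ z - φ y := (le_div_iff₀ hzy).1 hslope
  have h2 : s * (z - y) = M + 1 - φ y := by
    have : z - y = (M + 1 - φ y) / s := by rw [hz_def]; ring
    rw [this, mul_div_cancel₀ _ hs.ne']
  linarith [hM z (mem_Ici.1 hz)]

section Laws

variable {W : ℝ → ℝ → ℝ → ℝ}
  (hsymm : ∀ a b c : ℝ, W a b c = W b a c ∧ W a b c = W a c b)
  (hhom : ∀ ν : ℝ, 0 < ν → ∀ a b c : ℝ, 0 < a → 0 < b → 0 < c →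
    W (ν * a) (ν * b) (ν * c) = ν * W a b c)
  (hsub : ∀ a b c a' b' c' : ℝ, 0 < a → 0 < b → 0 < c → 0 < a' → 0 < b' → 0 < c' →
    W (a + a') (b + b') (c + c') ≤ W a b c + W a' b' c')
include hsymm hhom hsub

/-- NECESSITY of antitonicity for an ABSTRACT lawful functional: homogeneity + subadditivity make the far excess
convex, the ceiling `W(1,x,1) ≤ x+2` bounds it by `1`, hence it is non-increasing on `[1,∞)`. -/
theorem farExcess_antitone_of_laws (hlow : ∀ x : ℝ, 0 < x → x + 1 ≤ W 1 x 1)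
    (hup : ∀ x : ℝ, 0 < x → W 1 x 1 ≤ x + 2) :
    AntitoneOn (fun x : ℝ => W 1 x 1 - (x + 1)) (Ici 1) :=
  antitoneOn_of_convexOn_of_le (M := 1) (farExcess_free_of_laws hsymm hhom hsub hlow).1
    (fun x hx => by have := hup x (by linarith); linarith)

end Laws

/-- ★ FAR-TAIL FREEDOM, the characterisation.  A function `e : [1,∞) → ℝ` is the far excess of a 3D-LAWFUL
functional — symmetric, degree-1 homogeneous, subadditive, monotone, sandwiched — if and only if it is CONVEX,
ANTITONE, NONNEGATIVE and CUBE-LINE COUPLED `e(1) − e(x) ≤ (1 − e(1))/3 · (x − 1)`.  (`→`: Kernel I + the lemma above;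
`←`: the fold-shadow world of Kernel II, which moreover has `W(1,1,1) = 2 + e(1)`.)  The cube line — one linear
inequality at the square — is the ONLY coupling between the far tail and the rest of the functional. -/
theorem farPencil_iff {e : ℝ → ℝ} :
    (∃ W : ℝ → ℝ → ℝ → ℝ,
      (∀ a b c : ℝ, W a b c = W b a c ∧ W a b c = W a c b) ∧
      (∀ ν : ℝ, 0 < ν → ∀ a b c : ℝ, 0 < a → 0 < b → 0 < c →
        W (ν * a) (ν * b) (ν * c) = ν * W a b c) ∧
      (∀ a b c a' b' c' : ℝ, 0 < a → 0 < b → 0 < c → 0 < a' → 0 < b' → 0 < c' →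
        W (a + a') (b + b') (c + c') ≤ W a b c + W a' b' c') ∧
      (∀ a b b' c : ℝ, 0 < a → 0 < b → b ≤ b' → 0 < c → W a b c ≤ W a b' c) ∧
      (∀ a b c : ℝ, 0 < a → 0 < b → 0 < c →
        max (a + c) (max (a + b) (b + c)) ≤ W a b c ∧ W a b c ≤ a + b + c) ∧
      (∀ x : ℝ, 1 ≤ x → W 1 x 1 = x + 1 + e x)) ↔
    (ConvexOn ℝ (Ici 1) e ∧ AntitoneOn e (Ici 1) ∧ (∀ x : ℝ, 1 ≤ x → 0 ≤ e x) ∧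
      (∀ x : ℝ, 1 ≤ x → e 1 - e x ≤ (1 - e 1) / 3 * (x - 1))) := by
  constructor
  · rintro ⟨W, hsymm, hhom, hsub, -, hsand, hfar⟩
    have hlow : ∀ x : ℝ, 0 < x → x + 1 ≤ W 1 x 1 := fun x hx =>
      le_trans (le_trans (le_max_right _ _) (le_max_right _ _)) (hsand 1 x 1 one_pos hx one_pos).1
    have hup : ∀ x : ℝ, 0 < x → W 1 x 1 ≤ x + 2 := fun x hx => by
      have := (hsand 1 x 1 one_pos hx one_pos).2
      linarith
    have R := farExcess_free_of_laws hsymm hhom hsub hlow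
    have A := farExcess_antitone_of_laws hsymm hhom hsub hlow hup
    have heq : EqOn (fun x : ℝ => W 1 x 1 - (x + 1)) e (Ici 1) := fun x hx => by
      show W 1 x 1 - (x + 1) = e x
      rw [hfar x (mem_Ici.1 hx)]
      ring
    have he1 : e 1 = W 1 1 1 - (1 + 1) := by rw [hfar 1 le_rfl]; ring
    refine ⟨R.1.congr heq, A.congr heq, fun x hx => ?_, fun x hx => ?_⟩
    · rw [← heq (mem_Ici.2 hx)]
      exact R.2.1 x hx
    · have h := R.2.2 x hx
      have hx' : e x = W 1 x 1 - (x + 1) := (heq (mem_Ici.2 hx)).symm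
      rw [he1, hx']
      exact h
  · rintro ⟨hconv, hanti, hnn, hcube⟩
    obtain ⟨W, h1, h2, h3, h4, h5, h6, -⟩ := farTail_realisable hconv hanti hnn hcube
    exact ⟨W, h1, h2, h3, h4, h5, h6⟩

/-- The same with the square value recorded: every free tail is realised with `ω_W = W(1,1,1) = 2 + e(1)`, so the
far tail determines — and is constrained by — the square value only through `e(1)` and the cube-line slope budget
`(1 − e(1))/3`; in particular for EVERY admissible square excess `e(1) ∈ [0,1]` and every decay class compatible
with the cube line there is a lawful world (cf. `FarEdgeDescentTailWorlds.powerWorld`: `c(1+3δ) ≤ 1`). -/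
theorem farPencil_realisable_with_omega {e : ℝ → ℝ} (hconv : ConvexOn ℝ (Ici 1) e)
    (hanti : AntitoneOn e (Ici 1)) (hnn : ∀ x : ℝ, 1 ≤ x → 0 ≤ e x)
    (hcube : ∀ x : ℝ, 1 ≤ x → e 1 - e x ≤ (1 - e 1) / 3 * (x - 1)) :
    ∃ W : ℝ → ℝ → ℝ → ℝ,
      (∀ a b c : ℝ, W a b c = W b a c ∧ W a b c = W a c b) ∧
      (∀ ν : ℝ, 0 < ν → ∀ a b c : ℝ, 0 < a → 0 < b → 0 < c →
        W (ν * a) (ν * b) (ν * c) = ν * W a b c) ∧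
      (∀ a b c a' b' c' : ℝ, 0 < a → 0 < b → 0 < c → 0 < a' → 0 < b' → 0 < c' →
        W (a + a') (b + b') (c + c') ≤ W a b c + W a' b' c') ∧
      (∀ a b b' c : ℝ, 0 < a → 0 < b → b ≤ b' → 0 < c → W a b c ≤ W a b' c) ∧
      (∀ a b c : ℝ, 0 < a → 0 < b → 0 < c →
        max (a + c) (max (a + b) (b + c)) ≤ W a b c ∧ W a b c ≤ a + b + c) ∧
      (∀ x : ℝ, 1 ≤ x → W 1 x 1 = x + 1 + e x) ∧ W 1 1 1 = 2 + e 1 ∧ e 1 ≤ 1 :=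
  let ⟨W, h1, h2, h3, h4, h5, h6, h7⟩ := farTail_realisable hconv hanti hnn hcube
  ⟨W, h1, h2, h3, h4, h5, h6, h7, e_one_le_one hanti hcube⟩

end Summit.MatrixMultiplication.MatrixMultiplication.Theorems.FarEdgeDescentTailClass
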